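import Literature.AlgebraicTopology.Homotopy.StrongDeformationRetract
import HarnessLib

/-!
# Strong deformation retracts: squeezing the ambient set into a retracting neighbourhood

Topic `Literature/AlgebraicTopology/Homotopy`; a companion of `StrongDeformationRetract.lean`
(`IsStrongDeformationRetractOf A S`: "`A` is a strong deformation retract of `S`", with `.trans`,
composition of two deformation retractions). This file adds the other book-keeping step used to
assemble deformation retractions of *tubes* onto special fibres (Milnor fibrations, the
Clemens/SGA 7 retraction of a one-parameter family onto its special fibre — the named fact
`Literature.AlgebraicGeometry.HodgeTheory.exists_homotopyEquiv_fiberToTube`):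

* `IsStrongDeformationRetractOf.of_deformation_into` — **squeeze lemma**: if `A ⊆ W ⊆ S`, `A` is
  a strong deformation retract of `W`, and `S` can be deformed *inside itself* into `W` by a
  homotopy fixing `A` pointwise (a "squeeze" `G : [0, 1] × S → S`, `G₀ = id`, `G₁(S) ⊆ W`,
  `G_t = id` on `A`; `G` need NOT fix `W`, nor retract onto it), then `A` is a strong deformation
  retract of `S`: run the squeeze on `[0, ½]`, then the deformation of `W` on the squeezed image
  on `[½, 1]`.  This is how "the special fibre `X₀ = g⁻¹(0)` is a deformation retract of the tube
  `{g < ε}`" is obtained from (i) local triviality of `g` over `(0, ε₀)` (Hardt / Thom–Mather),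
  which squeezes `{g < ε}` into `{g < δ}` for every `δ`, and (ii) ONE neighbourhood `W ⊇ {g < δ}`
  of `X₀` retracting onto `X₀` (a regular neighbourhood from a triangulation) — cf. Durfee,
  *Neighborhoods of algebraic sets* (1983), §1, and van den Dries, *Tame topology* (1998), Ch. 8
  (3.3), Ch. 9 (1.7).
* `IsStrongDeformationRetractOf.of_deformation_into'` — the same with the squeeze given by a
  formula `G : ℝ → X → X` continuous on `[0, 1] × S` (the shape of `.of_continuousOn`);
  `.of_deformation_into_of_subset` — the nested-tubes form `A ⊆ T ⊆ W ⊆ S`, `G₁(S) ⊆ T`.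
* `IsStrongDeformationRetractOf.exists_homotopyEquiv_inclusion` — the inclusion `A ↪ S` of a strong
  deformation retract underlies a homotopy equivalence `A ≃ₕ S` (Hatcher, Ch. 0, p. 3); existence
  form with light imports (the data version lives in `Topology/FourManifolds/ClosedModelCollarCone`).

Elementary (Hatcher, *Algebraic Topology*, Ch. 0: concatenation of homotopies); no new notion.

## References

* A. Hatcher, *Algebraic Topology*, CUP (2002), Ch. 0, pp. 2–3. [HatcherAT2002]
* L. van den Dries, *Tame Topology and O-minimal Structures*, CUP (1998), Ch. 8 (3.3), Ch. 9 (1.7).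
  [Dries1998]
-/

noncomputable section

open Set Function
open scoped unitInterval Topology

namespace Literature.AlgebraicTopology.Homotopy

namespace IsStrongDeformationRetractOf

variable {X : Type*} [TopologicalSpace X] {A W S : Set X}

/-- **The inclusion of a strong deformation retract is a homotopy equivalence** `A ≃ₕ S` whose
forward map is the inclusion (homotopy inverse: the end `H₁ : S → A` of the deformation; Hatcher,
Ch. 0, p. 3). Existence form, import-light (the same construction, as data, is
`IsStrongDeformationRetractOf.homotopyEquiv` in `Topology/FourManifolds/ClosedModelCollarCone`).
[cite: HatcherAT2002, Ch. 0, p. 3] -/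
theorem exists_homotopyEquiv_inclusion (h : IsStrongDeformationRetractOf A S) (hAS : A ⊆ S) :
    ∃ e : ContinuousMap.HomotopyEquiv A S, e.toFun = ⟨Set.inclusion hAS, continuous_inclusion hAS⟩ := by
  obtain ⟨H, h0, h1, hfix⟩ := h
  -- the retraction `r = H₁ : S → A`
  let r : C(S, A) := ⟨fun x => ⟨(H (1, x) : X), h1 x⟩,
    (continuous_subtype_val.comp (H.continuous.comp (Continuous.prodMk_right 1))).subtype_mk _⟩
  let i : C(A, S) := ⟨Set.inclusion hAS, continuous_inclusion hAS⟩
  -- `r ∘ i = 𝟙` on the nose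
  have hri : r.comp i = ContinuousMap.id A := by
    ext y
    change ((H (1, ⟨y, hAS y.2⟩) : S) : X) = y
    rw [hfix 1 ⟨y, hAS y.2⟩ y.2]
  -- `𝟙 ≃ i ∘ r` by the deformation itself
  let K : ContinuousMap.Homotopy (ContinuousMap.id S) (i.comp r) :=
    { toFun := H
      continuous_toFun := H.continuous
      map_zero_left := fun x => h0 x
      map_one_left := fun _ => Subtype.ext rfl }
  refine ⟨{ toFun := i, invFun := r, left_inv := ?_, right_inv := ⟨K.symm⟩ }, rfl⟩
  rw [hri]

/-- **Squeeze lemma.** Let `W ⊆ S` and let `A` be a strong deformation retract of `W`. If there is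
a homotopy `G : [0, 1] × S → S` with `G₀ = id`, `G₁(S) ⊆ W` and `G_t = id` on the points of `A`,
then `A` is a strong deformation retract of `S` (first `G` at double speed, then the deformation
of `W` applied to `G₁`). [cite: HatcherAT2002, Ch. 0, pp. 2–3] -/
theorem of_deformation_into (hW : IsStrongDeformationRetractOf A W) (hWS : W ⊆ S)
    (G : C(I × S, S)) (hG0 : ∀ x, G (0, x) = x) (hG1 : ∀ x, (G (1, x) : X) ∈ W)
    (hGfix : ∀ (t : I) (x : S), (x : X) ∈ A → G (t, x) = x) :
    IsStrongDeformationRetractOf A S := by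
  obtain ⟨H, h0, h1, hfix⟩ := hW
  -- the end of the squeeze, as a map into `W`
  let e : S → W := fun x => ⟨(G (1, x) : X), hG1 x⟩
  have he : Continuous e :=
    (continuous_subtype_val.comp (G.continuous.comp (Continuous.prodMk_right 1))).subtype_mk _
  -- the inclusion `W → S`
  let ι : W → S := fun y => ⟨(y : X), hWS y.2⟩
  have hι : Continuous ι := continuous_subtype_val.subtype_mk _
  -- the two halves
  let F₁ : I × S → S := fun p => G (clampI (2 * (p.1 : ℝ)), p.2)
  let F₂ : I × S → S := fun p => ι (H (clampI (2 * (p.1 : ℝ) - 1), e p.2))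
  have hF₁ : Continuous F₁ :=
    G.continuous.comp ((continuous_clampI.comp ((continuous_const.mul
      (continuous_subtype_val.comp continuous_fst)))).prodMk continuous_snd)
  have hF₂ : Continuous F₂ :=
    hι.comp (H.continuous.comp ((continuous_clampI.comp (((continuous_const.mul
      (continuous_subtype_val.comp continuous_fst))).sub continuous_const)).prodMk
        (he.comp continuous_snd)))
  have hagree : ∀ p : I × S, (p.1 : ℝ) = 1 / 2 → F₁ p = F₂ p := by
    rintro ⟨t, x⟩ ht
    have ht' : (t : ℝ) = 1 / 2 := ht
    apply Subtype.ext
    simp only [F₁, F₂, ι, ht']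
    rw [show (2 : ℝ) * (1 / 2) = 1 by norm_num, sub_self, clampI_one, clampI_zero, h0]
  let F : I × S → S := fun p => if (p.1 : ℝ) ≤ 1 / 2 then F₁ p else F₂ p
  have hF : Continuous F :=
    continuous_if_le (continuous_subtype_val.comp continuous_fst) continuous_const
      hF₁.continuousOn hF₂.continuousOn fun p hp => hagree p hp
  refine ⟨⟨F, hF⟩, fun x => ?_, fun x => ?_, fun t x hx => ?_⟩
  · -- `F (0, x) = G (0, x) = x`
    show F (0, x) = x
    simp only [F, F₁, show ((0 : I) : ℝ) = 0 from rfl, mul_zero, clampI_zero]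
    rw [if_pos (by norm_num)]
    exact hG0 x
  · -- `F (1, x) = H (1, e x) ∈ A`
    show (F (1, x) : X) ∈ A
    simp only [F, F₂, show ((1 : I) : ℝ) = 1 from rfl]
    rw [if_neg (by norm_num), show (2 : ℝ) * 1 - 1 = 1 by norm_num, clampI_one]
    exact h1 (e x)
  · -- points of `A` are fixed by both halves
    have hxW : (x : X) ∈ W := by
      have h := hG1 x
      rwa [hGfix 1 x hx] at h
    have hex : e x = ⟨(x : X), hxW⟩ := by
      apply Subtype.ext
      show (G (1, x) : X) = x
      rw [hGfix 1 x hx]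
    show F (t, x) = x
    simp only [F]
    split_ifs with ht
    · exact hGfix _ x hx
    · apply Subtype.ext
      simp only [F₂, ι]
      rw [hex, hfix _ _ hx]

/-- **Squeeze lemma, formula form.** As `of_deformation_into`, with the squeeze given by a map
`G : ℝ → X → X` continuous on `[0, 1] × S`, mapping `S` into `S` at each time, equal to the
identity at time `0`, landing in `W` at time `1`, and fixing the points of `A ∩ S`.
[cite: HatcherAT2002, Ch. 0, pp. 2–3] -/
theorem of_deformation_into' (hW : IsStrongDeformationRetractOf A W) (hWS : W ⊆ S)
    (G : ℝ → X → X) (hcont : ContinuousOn (fun p : ℝ × X => G p.1 p.2) (Icc (0 : ℝ) 1 ×ˢ S))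
    (hmaps : ∀ t ∈ Icc (0 : ℝ) 1, MapsTo (G t) S S) (hG0 : ∀ x ∈ S, G 0 x = x)
    (hG1 : ∀ x ∈ S, G 1 x ∈ W) (hGfix : ∀ t ∈ Icc (0 : ℝ) 1, ∀ x ∈ S, x ∈ A → G t x = x) :
    IsStrongDeformationRetractOf A S := by
  have hc : Continuous fun p : I × S => (⟨G p.1 p.2, hmaps p.1 p.1.2 p.2.2⟩ : S) := by
    refine Continuous.subtype_mk ?_ _
    have h1 : Continuous fun p : I × S => ((p.1 : ℝ), (p.2 : X)) :=
      (continuous_subtype_val.comp continuous_fst).prodMk (continuous_subtype_val.comp continuous_snd)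
    exact hcont.comp_continuous h1 fun p => ⟨p.1.2, p.2.2⟩
  refine of_deformation_into hW hWS ⟨fun p => ⟨G p.1 p.2, hmaps p.1 p.1.2 p.2.2⟩, hc⟩
    (fun x => Subtype.ext (hG0 x x.2)) (fun x => hG1 x x.2)
    (fun t x hx => Subtype.ext (hGfix t t.2 x x.2 hx))

/-- **Corollary (nested tubes).** If `A ⊆ W ⊆ S`, `A` is a strong deformation retract of `W`, and
`W` contains a set `T ⊆ S` into which `S` deforms inside itself relative to `A`
(`G₁(S) ⊆ T`), then `A` is a strong deformation retract of `S`. (The form used for tubes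
`A = X₀ ⊆ T = {g < δ} ⊆ W ⊆ S = {g < ε}`.) [cite: HatcherAT2002, Ch. 0, pp. 2–3] -/
theorem of_deformation_into_of_subset {T : Set X} (hW : IsStrongDeformationRetractOf A W)
    (hWS : W ⊆ S) (hTW : T ⊆ W) (G : C(I × S, S)) (hG0 : ∀ x, G (0, x) = x)
    (hG1 : ∀ x, (G (1, x) : X) ∈ T) (hGfix : ∀ (t : I) (x : S), (x : X) ∈ A → G (t, x) = x) :
    IsStrongDeformationRetractOf A S :=
  of_deformation_into hW hWS G hG0 (fun x => hTW (hG1 x)) hGfix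

end IsStrongDeformationRetractOf

end Literature.AlgebraicTopology.Homotopy

end
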